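import Literature.RingTheory.TightClosure.RegularTightlyClosed
import Mathlib.RingTheory.RegularLocalRing.Defs
import Mathlib.RingTheory.LocalProperties.Basic
import Mathlib.Algebra.CharP.Algebra
import HarnessLib

/-!
# Regular domains of prime characteristic are weakly F-regular (inline clause)

Route `FrobeniusLadder`, crux `FRationalResolution` (stmt-ResolutionOfSingularities-15317), line
`Sketch`: the inserted rung "weakly F-regular" asks that every stalk be a domain in which EVERY ideal is
tightly closed, in the inline form
`∀ I y c, c ≠ 0 → (∀ e, c · y ^ (p ^ e) ∈ span {z ^ (p ^ e) | z ∈ I}) → y ∈ I`.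

The tree proves this clause for regular LOCAL rings
(`Literature.RingTheory.TightClosure.isTightlyClosed_of_isRegularLocalRing`, Hochster–Huneke via Kunz,
unfolded by `isTightlyClosed_iff_of_isDomain`). Here we globalise it to regular DOMAINS in the sense of
Mathlib's `IsRegularRing` (Noetherian, every localization at a prime a regular local ring): membership
`y ∈ I` is checked after localizing at every maximal ideal `J` (`Ideal.mem_of_localization_maximal`),
where `Localization.AtPrime J` is a regular local domain of characteristic `p` and the hypothesis of the
clause is transported along `algebraMap R (Localization.AtPrime J)`
(`weaklyFRegularClause_of_isRegularRing_map_mem_span_pow_image`). This is the classical statement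
"every ideal of a regular ring of characteristic `p` is tightly closed" [HochsterHuneke1990, Thm. 4.4;
BrunsHerzog1998, Thm. 10.1.7 (b)] in the domain case.
-/

-- single-problem summit: the doubled namespace component is forced
set_option linter.dupNamespace false

noncomputable section

open Literature.RingTheory.TightClosure

namespace Summit.ResolutionOfSingularities.ResolutionOfSingularities.Theorems.FRationalResolution

/-- The hypothesis of the inline tight-closure clause is transported along a ring map `f : R → S`:
if `a ∈ span {z ^ q | z ∈ I}` then `f a ∈ span {w ^ q | w ∈ I S}` (since `f (z ^ q) = (f z) ^ q` with
`f z ∈ I S`). [folklore] -/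
theorem weaklyFRegularClause_of_isRegularRing_map_mem_span_pow_image {R S : Type*} [CommRing R]
    [CommRing S] (f : R →+* S) {I : Ideal R} {q : ℕ} {a : R}
    (h : a ∈ Ideal.span ((fun z : R => z ^ q) '' (I : Set R))) :
    f a ∈ Ideal.span ((fun z : S => z ^ q) '' (I.map f : Set S)) := by
  have hle : Ideal.map f (Ideal.span ((fun z : R => z ^ q) '' (I : Set R))) ≤
      Ideal.span ((fun z : S => z ^ q) '' (I.map f : Set S)) := by
    rw [Ideal.map_span]
    refine Ideal.span_mono ?_
    rintro _ ⟨_, ⟨z, hz, rfl⟩, rfl⟩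
    exact ⟨f z, Ideal.mem_map_of_mem f hz, (map_pow f z q).symm⟩
  exact hle (Ideal.mem_map_of_mem f h)

/-- **Regular domains of prime characteristic are weakly F-regular** (inline clause): in a domain `R`
of prime characteristic `p` which is a regular ring (Mathlib's `IsRegularRing`: Noetherian with all
localizations at primes regular local), for every ideal `I` and all `y c : R` with `c ≠ 0`,
`c · y ^ (p ^ e) ∈ span {z ^ (p ^ e) | z ∈ I}` for every `e` forces `y ∈ I`. Proof: localize at a
maximal ideal `J` (`Ideal.mem_of_localization_maximal`); `R_J` is a regular local domain of
characteristic `p`, so every ideal of `R_J` is tightly closed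
(`isTightlyClosed_of_isRegularLocalRing`, unfolded by `isTightlyClosed_iff_of_isDomain`), and the
hypothesis maps to `R_J` along the injective `algebraMap`.
[cite: HochsterHuneke1990, Thm. 4.4; BrunsHerzog1998, Thm. 10.1.7 (b)] -/
theorem weaklyFRegularClause_of_isRegularRing (p : ℕ) [Fact p.Prime] (R : Type) [CommRing R] [IsDomain R] [CharP R p] [IsRegularRing R] : ∀ I : Ideal R, ∀ y c : R, c ≠ 0 → (∀ e : ℕ, c * y ^ p ^ e ∈ Ideal.span ((fun z : R => z ^ p ^ e) '' (I : Set R))) → y ∈ I := by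
  intro I y c hc h
  refine Ideal.mem_of_localization_maximal fun J hJ => ?_
  have hinj : Function.Injective (algebraMap R (Localization.AtPrime J)) :=
    IsLocalization.injective (Localization.AtPrime J) J.primeCompl_le_nonZeroDivisors
  haveI : CharP (Localization.AtPrime J) p := charP_of_injective_algebraMap hinj p
  refine (isTightlyClosed_iff_of_isDomain p).mp
    (isTightlyClosed_of_isRegularLocalRing p (I.map (algebraMap R (Localization.AtPrime J))))
    (algebraMap R _ y) (algebraMap R _ c) ((map_ne_zero_iff _ hinj).mpr hc) fun e => ?_
  have hmem := weaklyFRegularClause_of_isRegularRing_map_mem_span_pow_image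
    (algebraMap R (Localization.AtPrime J)) (h e)
  rwa [map_mul, map_pow] at hmem

end Summit.ResolutionOfSingularities.ResolutionOfSingularities.Theorems.FRationalResolution

end
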